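import Summits.QuantumFields.YangMills.Theorems.DressedRitz.Negative.LevelRotationBalance
import Summits.QuantumFields.YangMills.Theorems.DressedRitz.Negative.LeakageMixtureHazard
import Summits.QuantumFields.YangMills.Theorems.LuscherReductionDressedRitzPolyakovLiftStaticsOfLeakage
import Summits.QuantumFields.YangMills.Theorems.LuscherReductionDressedRitzPolyakovLiftTransplantStaticsLR
import HarnessLib

/-!
# Crux `DressedRitz` (stmt-QuantumFields-20205), line «polyakovlift» r8 — the `∀`-basis LEAKAGE text `LeakageForL (TransplantBasisLR k)` read through
# rotations inside a degenerate level of `𝔥`: ★★ RITZ-VALUE AGREEMENT of the dressed lifts across the level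

Standing crux disprover `ym-cdisprove-20205-1` g11 (refuter), supporting item stmt-QuantumFields-20205 (no verdict change; negative-side bookkeeping
for the provers of `stub_liftLeakage : ∀ k, LeakageForL (TransplantBasisLR k)` of skeleton r8 `7611d10d84d95233`).

THE POINT.  `TransplantBasisLR k L Λ` is CLOSED under rotations of two excited members at the same min–max level of `𝔥`
(`Negative.transplantBasisLR_levelRotation`, g10) and the dressed lift is linear, but clause (o4) of `LeakageClause` (left side `‖u‖²·dist(K_βu, ℝu)²`)
is NOT rotation-covariant: `cu_a + su_b` is close to an eigenvector of `K_β` only if the two Ritz values nearly COINCIDE.  Quantitatively (§2–§3,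
Cauchy–Schwarz only, `K_β` symmetric on physical functions): (o4) with tolerance `E‖w‖⁴` for `u`, `v` and every `w = cu + sv`, `c² + s² = 1` ⟹
`(r_u − r_v)² ≤ 32E`, `r_w = ⟨w,Kw⟩/‖w‖²` (★ `ritz_sub_sq_le_of_rotationLeakage`), whatever the angle `⟨u,v⟩`.  For the registered text (§4) ★★
`leakageForL_transplantLR_levelRitzAgreement`: `LeakageForL (TransplantBasisLR k)` ⟹ with the SAME `C, lam0, L0(lam)`, for every `β` in the femto
window, raw vacuum `φ`, AL1 family `f` (`f_0 > 0`), admissible `R` and pair `a ≠ b` with `physLevel (a+2) = physLevel (b+2)` whose dressed lifts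
`u_i = dressedLiftVec β φ (transplantObsL L λ R f i)` are non-null: `(r_a − r_b)² ≤ 32·C·(λ³/L²)·λ₀²` (`λ = luscherLambda β L`, `λ₀ = levelValue su2Rep L β 0`);
★★ primed version with non-nullity discharged by `o0_level_transplantLR`.  Sharp ORDER (§5, `leakageClause_mixture_iff`, from g0's
`Negative.leakage_defect_of_mixture`): an equal mixture of two orthonormal exact eigenvectors passes (o4) iff `(κ₁ − κ₂)² ≤ 4·C(λ³/L²)λ₀²`.

WHERE IT BITES (physics, not asserted in Lean).  `𝔥 = −½Δ + ¼[(tr G)² − tr G²]` is spatially `O(3)`-symmetric; its first excited colour-singlet level is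
the `J = 2⁺` quintet, split by the cubic lattice only at relative order `λ³` into `E⁺ ⊕ T₂⁺` [cite: Vanbaal2001, §4] [cite: LuscherMunster1984, §4]
[cite: Luscher1983, §2–§3].  Granting that assignment, from `k = 2` the registered text ranges over bases MIXING `E` and `T₂` states, so any proof of
`stub_liftLeakage` must know that the dressed `E` and `T₂` lifts have Ritz values equal to `O(√C·λ^{3/2}/L)·λ₀`; physically that splitting is
`(λ/L)·O(λ³) = O(λ⁴/L)·λ₀` — MET with room (information: a leakage constant certified only on isotype-ALIGNED bases does not cover the text, while
unrelated `O(λ²/L)` energy bookkeeping per isotype still suffices), NOT a refutation (g11 verdict: no kill).  Companion of g10's norm balance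
`Negative.staticsForL_transplantLR_levelBalance` for the statics text.  HONEST FRAMING: bilinear algebra at fixed lattice on the CONDITIONAL femto
rung R2b1 (RunningReduction ⇐ TwistedTraceScaling ∧ DressedRitz); no estimate on `𝔥` or on `K_β` is proved, no level assignment is asserted; nothing
here bears on infinite volume, the continuum limit or the Clay mass gap.  [folklore]
-/

set_option autoImplicit false

noncomputable section

open MeasureTheory Filter Topology Real
open Literature.MathematicalPhysics.QuantumFieldTheory Literature.MathematicalPhysics.QuantumLattice Literature.Analysis.OperatorTheory.YMMatrixModel
open scoped BigOperators

namespace Summit.QuantumFields.YangMills.Theorems.FemtoTransferGap.PolyakovLift.Negative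

open Summit.QuantumFields.YangMills.Theorems.FemtoTransferGap Summit.QuantumFields.YangMills.Theorems.FemtoTransferGap.PolyakovLift

/-! ## §1 Fine-lattice `l2` algebra: sums, null vectors, homogeneity of the leakage defect, the residual

Notation of the docstrings: `K = transferApply β`, `V(w) = ‖Kw‖²‖w‖² − ⟨w,Kw⟩²` (the LEAKAGE DEFECT, left side of (o4)), `res w = Kw − (⟨w,Kw⟩/‖w‖²)w`
(the residual at the Ritz value; Lean's `x/0 = 0` makes it `Kw` on null vectors).  Both are written out in the statements (no new definitions). -/

section FineAlgebra

variable {L : ℕ} [NeZero L] (β : ℝ)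

/-- `‖a + b‖² ≤ 2(‖a‖² + ‖b‖²)` for physical test functions. [folklore] -/
theorem l2_add_self_le_two {a b : GaugeConfig 3 L SU2 → ℝ} (ha : IsPhys a) (hb : IsPhys b) :
    l2 (a + b) (a + b) ≤ 2 * (l2 a a + l2 b b) := by
  have e1 : a + b = (1 : ℝ) • a + (1 : ℝ) • b := by simp
  have h1 : l2 (a + b) (a + b) = l2 a a + 2 * l2 a b + l2 b b := by
    rw [e1, l2_self_add_smul ha hb 1 1]; ring
  have h2 : 0 ≤ l2 a a - 2 * l2 a b + l2 b b := by
    have h := l2_self_nonneg ((1 : ℝ) • a + (-1 : ℝ) • b)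
    rw [l2_self_add_smul ha hb 1 (-1)] at h
    linarith
  linarith

/-- `‖(-1)•a‖² = ‖a‖²`. [folklore] -/
theorem l2_neg_one_smul_self (a : GaugeConfig 3 L SU2 → ℝ) : l2 ((-1 : ℝ) • a) ((-1 : ℝ) • a) = l2 a a := by
  rw [l2_smul_left, l2_smul_right'']; ring

/-- `K_β` of a null physical vector is null (Cauchy–Schwarz: a null vector pairs to zero with every physical function). [folklore] -/
theorem l2_transferApply_self_eq_zero_of_null {w : GaugeConfig 3 L SU2 → ℝ} (hw : IsPhys w) (h0 : l2 w w = 0) :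
    l2 (transferApply β w) (transferApply β w) = 0 := by
  rw [l2_transferApply_comm β hw (isPhys_transferApply β hw)]
  have h := sq_l2_le hw (isPhys_transferApply β (isPhys_transferApply β hw))
  rw [h0, zero_mul] at h
  exact pow_eq_zero_iff two_ne_zero |>.1 (le_antisymm h (sq_nonneg _))

/-- Homogeneity of the leakage defect: `V(t•w) = t⁴ V(w)`. [folklore] -/
theorem leakDefect_smul (t : ℝ) (w : GaugeConfig 3 L SU2 → ℝ) :
    l2 (transferApply β (t • w)) (transferApply β (t • w)) * l2 (t • w) (t • w) - l2 (t • w) (transferApply β (t • w)) ^ 2 =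
      t ^ 4 * (l2 (transferApply β w) (transferApply β w) * l2 w w - l2 w (transferApply β w) ^ 2) := by
  rw [transferApply_smul, l2_smul_left, l2_smul_right'', l2_smul_left, l2_smul_right'', l2_smul_left, l2_smul_right'']
  ring

/-- Homogeneity of the (o4)-type bound: `V(w) ≤ E‖w‖⁴ ⟹ V(t•w) ≤ E‖t•w‖⁴`. [folklore] -/
theorem leakBound_smul {E : ℝ} {w : GaugeConfig 3 L SU2 → ℝ}
    (h : l2 (transferApply β w) (transferApply β w) * l2 w w - l2 w (transferApply β w) ^ 2 ≤ E * l2 w w ^ 2) (t : ℝ) :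
    l2 (transferApply β (t • w)) (transferApply β (t • w)) * l2 (t • w) (t • w) - l2 (t • w) (transferApply β (t • w)) ^ 2 ≤
      E * l2 (t • w) (t • w) ^ 2 := by
  rw [leakDefect_smul, l2_smul_left, l2_smul_right'']
  calc t ^ 4 * (l2 (transferApply β w) (transferApply β w) * l2 w w - l2 w (transferApply β w) ^ 2)
        = (t ^ 2) ^ 2 * (l2 (transferApply β w) (transferApply β w) * l2 w w - l2 w (transferApply β w) ^ 2) := by ring
    _ ≤ (t ^ 2) ^ 2 * (E * l2 w w ^ 2) := mul_le_mul_of_nonneg_left h (sq_nonneg _)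
    _ = E * (t * (t * l2 w w)) ^ 2 := by ring

/-- ★ **From the leakage defect to the residual, null-safe**: `V(w) ≤ E‖w‖⁴ ⟹ ‖res w‖² ≤ E‖w‖²` (for `‖w‖² > 0` divide; a null `w` has a null `K w`).
[folklore] -/
theorem l2_ritzResidual_self_le {E : ℝ} {w : GaugeConfig 3 L SU2 → ℝ} (hw : IsPhys w)
    (h : l2 (transferApply β w) (transferApply β w) * l2 w w - l2 w (transferApply β w) ^ 2 ≤ E * l2 w w ^ 2) :
    l2 (transferApply β w + (-(l2 w (transferApply β w) / l2 w w)) • w) (transferApply β w + (-(l2 w (transferApply β w) / l2 w w)) • w) ≤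
      E * l2 w w := by
  rcases (l2_self_nonneg w).eq_or_lt with h0 | hpos
  · -- null vector
    have h0' : l2 w w = 0 := h0.symm
    have hres : transferApply β w + (-(l2 w (transferApply β w) / l2 w w)) • w = transferApply β w := by
      rw [h0', div_zero, neg_zero, zero_smul, add_zero]
    rw [hres, l2_transferApply_self_eq_zero_of_null β hw h0', h0', mul_zero]
  · rw [l2_residual_self β hw hpos]
    have e : l2 (transferApply β w) (transferApply β w) - l2 w (transferApply β w) ^ 2 / l2 w w =
        (l2 (transferApply β w) (transferApply β w) * l2 w w - l2 w (transferApply β w) ^ 2) / l2 w w := by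
      field_simp
    rw [e, div_le_iff₀ hpos]
    calc _ ≤ E * l2 w w ^ 2 := h
      _ = E * l2 w w * l2 w w := by ring

/-- The residual PACKAGED: a physical vector `ρ = res w` with `‖ρ‖² ≤ E‖w‖²` (keeps the later statements free of the residual's formula). [folklore] -/
theorem exists_ritzResidual {E : ℝ} {w : GaugeConfig 3 L SU2 → ℝ} (hw : IsPhys w)
    (h : l2 (transferApply β w) (transferApply β w) * l2 w w - l2 w (transferApply β w) ^ 2 ≤ E * l2 w w ^ 2) :
    ∃ ρ : GaugeConfig 3 L SU2 → ℝ, IsPhys ρ ∧ l2 ρ ρ ≤ E * l2 w w ∧ transferApply β w + (-(l2 w (transferApply β w) / l2 w w)) • w = ρ :=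
  ⟨_, (isPhys_transferApply β hw).add (hw.smul _), l2_ritzResidual_self_le β hw h, rfl⟩

end FineAlgebra

/-! ## §2 Two unit vectors: the rotated residual controls `(r_U − μ)U + (r_V − μ)V` -/

section TwoUnit

variable {L : ℕ} [NeZero L] (β : ℝ) {U V : GaugeConfig 3 L SU2 → ℝ}

/-- For UNIT physical `U, V` (`‖U‖² = ‖V‖² = 1`) passing the leakage bound with tolerance `E` together with `U + V`: with `μ = ⟨U+V, K(U+V)⟩/‖U+V‖²`
the Ritz value of `U + V`, `r_U = ⟨U,KU⟩`, `r_V = ⟨V,KV⟩` and `p = ⟨U,V⟩`,  `(r_U − μ)² + 2(r_U − μ)(r_V − μ)p + (r_V − μ)² ≤ 16E`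
(the vector `(r_U − μ)U + (r_V − μ)V = res(U+V) − res U − res V` has that squared norm; `‖res U‖², ‖res V‖² ≤ E`, `‖res(U+V)‖² ≤ 4E`). [folklore] -/
theorem rot_form_le {E : ℝ} (hU : IsPhys U) (hV : IsPhys V) (h1U : l2 U U = 1) (h1V : l2 V V = 1)
    (hLU : l2 (transferApply β U) (transferApply β U) * l2 U U - l2 U (transferApply β U) ^ 2 ≤ E * l2 U U ^ 2)
    (hLV : l2 (transferApply β V) (transferApply β V) * l2 V V - l2 V (transferApply β V) ^ 2 ≤ E * l2 V V ^ 2)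
    (hLW : l2 (transferApply β (U + V)) (transferApply β (U + V)) * l2 (U + V) (U + V) - l2 (U + V) (transferApply β (U + V)) ^ 2 ≤
      E * l2 (U + V) (U + V) ^ 2)
    (μ : ℝ) (hμ : l2 (U + V) (transferApply β (U + V)) / l2 (U + V) (U + V) = μ) :
    (l2 U (transferApply β U) - μ) ^ 2 + 2 * ((l2 U (transferApply β U) - μ) * (l2 V (transferApply β V) - μ)) * l2 U V +
      (l2 V (transferApply β V) - μ) ^ 2 ≤ 16 * E := by
  obtain ⟨ρU, hρU, hnU, eU⟩ := exists_ritzResidual β hU hLU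
  obtain ⟨ρV, hρV, hnV, eV⟩ := exists_ritzResidual β hV hLV
  obtain ⟨ρW, hρW, hnW, eW⟩ := exists_ritzResidual β (hU.add hV) hLW
  rw [h1U, mul_one] at hnU
  rw [h1V, mul_one] at hnV
  -- the vector identity (pointwise, so that `μ` stays one atom)
  have hKUVx : ∀ x, transferApply β (U + V) x = transferApply β U x + transferApply β V x := fun x => by
    simp only [transferApply_add β hU hV, Pi.add_apply]
  have hX : (l2 U (transferApply β U) - μ) • U + (l2 V (transferApply β V) - μ) • V = ((-1 : ℝ) • ρU + (-1 : ℝ) • ρV) + ρW := by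
    rw [← eU, ← eV, ← eW, h1U, h1V, div_one, div_one, hμ]
    funext x
    simp only [Pi.add_apply, Pi.smul_apply, smul_eq_mul, hKUVx]
    ring
  have hUV : l2 (U + V) (U + V) ≤ 4 := by
    have h := l2_add_self_le_two hU hV; rw [h1U, h1V] at h; linarith
  have hE : 0 ≤ E := (l2_self_nonneg _).trans hnU
  have hlhs : l2 ((l2 U (transferApply β U) - μ) • U + (l2 V (transferApply β V) - μ) • V)
        ((l2 U (transferApply β U) - μ) • U + (l2 V (transferApply β V) - μ) • V) =
      (l2 U (transferApply β U) - μ) ^ 2 + 2 * ((l2 U (transferApply β U) - μ) * (l2 V (transferApply β V) - μ)) * l2 U V +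
        (l2 V (transferApply β V) - μ) ^ 2 := by
    rw [l2_self_add_smul hU hV, h1U, h1V]; ring
  rw [← hlhs, hX]
  calc l2 ((-1 : ℝ) • ρU + (-1 : ℝ) • ρV + ρW) ((-1 : ℝ) • ρU + (-1 : ℝ) • ρV + ρW)
        ≤ 2 * (l2 ((-1 : ℝ) • ρU + (-1 : ℝ) • ρV) ((-1 : ℝ) • ρU + (-1 : ℝ) • ρV) + l2 ρW ρW) :=
          l2_add_self_le_two ((hρU.smul _).add (hρV.smul _)) hρW
    _ ≤ 2 * (2 * (l2 ((-1 : ℝ) • ρU) ((-1 : ℝ) • ρU) + l2 ((-1 : ℝ) • ρV) ((-1 : ℝ) • ρV)) + l2 ρW ρW) := by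
          gcongr; exact l2_add_self_le_two (hρU.smul _) (hρV.smul _)
    _ = 2 * (2 * (l2 ρU ρU + l2 ρV ρV) + l2 ρW ρW) := by rw [l2_neg_one_smul_self, l2_neg_one_smul_self]
    _ ≤ 2 * (2 * (E + E) + E * 4) := by gcongr; exact hnW.trans (mul_le_mul_of_nonneg_left hUV hE)
    _ = 16 * E := by ring

/-- The real-number core: `|p| ≤ 1`, `α − γ = α′ − γ′`, `α² + 2αγp + γ² ≤ M`, `α′² − 2α′γ′p + γ′² ≤ M`, `0 ≤ M` ⟹ `(α − γ)² ≤ 2M`. [folklore] -/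
theorem sq_sub_le_of_two_rotForms {α γ α' γ' p M : ℝ} (hp1 : p ≤ 1) (hp2 : -1 ≤ p) (hM : 0 ≤ M)
    (h1 : α ^ 2 + 2 * (α * γ) * p + γ ^ 2 ≤ M) (h2 : α' ^ 2 + 2 * (α' * γ') * (-p) + γ' ^ 2 ≤ M) (hΔ : α - γ = α' - γ') :
    (α - γ) ^ 2 ≤ 2 * M := by
  rcases le_total 0 p with hp | hp
  · -- use the second form (angle −p)
    rw [hΔ]
    rcases le_total 0 (α' * γ') with hs | hs
    · nlinarith [mul_nonneg hs (sub_nonneg.2 hp1), mul_nonneg hs hp]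
    · nlinarith [mul_nonneg_of_nonpos_of_nonpos hs (neg_nonpos.2 hp), sq_nonneg (α' + γ')]
  · rcases le_total 0 (α * γ) with hs | hs
    · nlinarith [mul_nonneg hs (neg_nonneg.2 hp), mul_nonneg hs (show 0 ≤ p + 1 by linarith)]
    · nlinarith [mul_nonneg_of_nonpos_of_nonpos hs hp, sq_nonneg (α + γ)]

/-- ★ UNIT form of the Ritz agreement: unit physical `U, V` passing the leakage bound with tolerance `E` together with `U + V` and `U − V` ⟹
`(r_U − r_V)² ≤ 32E` (apply `rot_form_le` to `(U, V)` and to `(U, −V)`: the two quadratic forms have opposite angle, `sq_sub_le_of_two_rotForms`). [folklore] -/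
theorem ritz_sub_sq_le_unit {E : ℝ} (hU : IsPhys U) (hV : IsPhys V) (h1U : l2 U U = 1) (h1V : l2 V V = 1)
    (hLU : l2 (transferApply β U) (transferApply β U) * l2 U U - l2 U (transferApply β U) ^ 2 ≤ E * l2 U U ^ 2)
    (hLV : l2 (transferApply β V) (transferApply β V) * l2 V V - l2 V (transferApply β V) ^ 2 ≤ E * l2 V V ^ 2)
    (hLW : l2 (transferApply β (U + V)) (transferApply β (U + V)) * l2 (U + V) (U + V) - l2 (U + V) (transferApply β (U + V)) ^ 2 ≤
      E * l2 (U + V) (U + V) ^ 2)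
    (hLW' : l2 (transferApply β (U + (-1 : ℝ) • V)) (transferApply β (U + (-1 : ℝ) • V)) * l2 (U + (-1 : ℝ) • V) (U + (-1 : ℝ) • V) -
        l2 (U + (-1 : ℝ) • V) (transferApply β (U + (-1 : ℝ) • V)) ^ 2 ≤ E * l2 (U + (-1 : ℝ) • V) (U + (-1 : ℝ) • V) ^ 2) :
    (l2 U (transferApply β U) - l2 V (transferApply β V)) ^ 2 ≤ 32 * E := by
  have hE : 0 ≤ E := by
    have h := sq_l2_le hU (isPhys_transferApply β hU)
    have h' := hLU
    simp only [h1U, one_mul, mul_one, one_pow] at h h'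
    linarith
  have hV' : IsPhys ((-1 : ℝ) • V) := hV.smul _
  have h1V' : l2 ((-1 : ℝ) • V) ((-1 : ℝ) • V) = 1 := by rw [l2_neg_one_smul_self, h1V]
  have hLV' := leakBound_smul β hLV (-1)
  obtain ⟨μ, hμ⟩ : ∃ μ : ℝ, l2 (U + V) (transferApply β (U + V)) / l2 (U + V) (U + V) = μ := ⟨_, rfl⟩
  obtain ⟨μ', hμ'⟩ : ∃ μ' : ℝ, l2 (U + (-1 : ℝ) • V) (transferApply β (U + (-1 : ℝ) • V)) / l2 (U + (-1 : ℝ) • V) (U + (-1 : ℝ) • V) = μ' :=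
    ⟨_, rfl⟩
  have hF1 := rot_form_le β hU hV h1U h1V hLU hLV hLW μ hμ
  have hF2 := rot_form_le β hU hV' h1U h1V' hLU hLV' hLW' μ' hμ'
  have hrV' : l2 ((-1 : ℝ) • V) (transferApply β ((-1 : ℝ) • V)) = l2 V (transferApply β V) := by
    rw [transferApply_smul, l2_smul_left, l2_smul_right'']; ring
  have hpV' : l2 U ((-1 : ℝ) • V) = -l2 U V := by rw [l2_smul_right'']; ring
  rw [hrV', hpV'] at hF2
  have hp : l2 U V ^ 2 ≤ 1 := by have h := sq_l2_le hU hV; rwa [h1U, h1V, mul_one] at h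
  obtain ⟨hp2, hp1⟩ := abs_le.1 ((sq_le_one_iff_abs_le_one _).1 hp)
  have key := sq_sub_le_of_two_rotForms hp1 hp2 (by linarith) hF1 hF2 (by ring)
  have e : l2 U (transferApply β U) - l2 V (transferApply β V) = (l2 U (transferApply β U) - μ) - (l2 V (transferApply β V) - μ) := by ring
  rw [e]
  linarith

end TwoUnit

/-! ## §3 ★ Ritz-value agreement of two physical vectors whose every rotation passes (o4) -/

section RitzAgreement

variable {L : ℕ} [NeZero L] (β : ℝ) {u v : GaugeConfig 3 L SU2 → ℝ}

/-- ★ **Ritz values agree when every rotation of the pair passes the leakage bound.**  Physical `u, v` with `‖u‖², ‖v‖² > 0`; if `V(w) ≤ E‖w‖⁴` for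
`w = u`, `w = v` and every `w = c•u + s•v` with `c² + s² = 1` (`V` the leakage defect, left side of (o4)), then `(⟨u,Ku⟩/‖u‖² − ⟨v,Kv⟩/‖v‖²)² ≤ 32·E`
— whatever the angle between `u` and `v` (sharp order: `Negative.leakage_defect_of_mixture`). [cite: LuscherWolff1990] [cite: DavisKahan1970, §2] -/
theorem ritz_sub_sq_le_of_rotationLeakage (hu : IsPhys u) (hv : IsPhys v) (hnu : 0 < l2 u u) (hnv : 0 < l2 v v) {E : ℝ}
    (hleak_u : l2 (transferApply β u) (transferApply β u) * l2 u u - l2 u (transferApply β u) ^ 2 ≤ E * l2 u u ^ 2)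
    (hleak_v : l2 (transferApply β v) (transferApply β v) * l2 v v - l2 v (transferApply β v) ^ 2 ≤ E * l2 v v ^ 2)
    (hleak_rot : ∀ c s : ℝ, c ^ 2 + s ^ 2 = 1 →
      l2 (transferApply β (c • u + s • v)) (transferApply β (c • u + s • v)) * l2 (c • u + s • v) (c • u + s • v) -
          l2 (c • u + s • v) (transferApply β (c • u + s • v)) ^ 2 ≤ E * l2 (c • u + s • v) (c • u + s • v) ^ 2) :
    (l2 u (transferApply β u) / l2 u u - l2 v (transferApply β v) / l2 v v) ^ 2 ≤ 32 * E := by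
  obtain ⟨a, ha0, ha2⟩ : ∃ a : ℝ, 0 < a ∧ a ^ 2 * l2 u u = 1 :=
    ⟨(Real.sqrt (l2 u u))⁻¹, inv_pos.2 (Real.sqrt_pos.2 hnu), by rw [inv_pow, Real.sq_sqrt hnu.le, inv_mul_cancel₀ hnu.ne']⟩
  obtain ⟨b, hb0, hb2⟩ : ∃ b : ℝ, 0 < b ∧ b ^ 2 * l2 v v = 1 :=
    ⟨(Real.sqrt (l2 v v))⁻¹, inv_pos.2 (Real.sqrt_pos.2 hnv), by rw [inv_pow, Real.sq_sqrt hnv.le, inv_mul_cancel₀ hnv.ne']⟩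
  obtain ⟨t, ht0, ht2⟩ : ∃ t : ℝ, 0 < t ∧ t ^ 2 = a ^ 2 + b ^ 2 :=
    ⟨Real.sqrt (a ^ 2 + b ^ 2), Real.sqrt_pos.2 (by positivity), Real.sq_sqrt (by positivity)⟩
  have hU : IsPhys (a • u) := hu.smul a
  have hV : IsPhys (b • v) := hv.smul b
  have h1U : l2 (a • u) (a • u) = 1 := by rw [l2_smul_left, l2_smul_right'', ← ha2]; ring
  have h1V : l2 (b • v) (b • v) = 1 := by rw [l2_smul_left, l2_smul_right'', ← hb2]; ring
  -- the two mixtures `a•u ± b•v` are scaled admissible rotations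
  have hcs : (a / t) ^ 2 + (b / t) ^ 2 = 1 := by
    rw [show (a / t) ^ 2 + (b / t) ^ 2 = (a ^ 2 + b ^ 2) / t ^ 2 by ring, ← ht2, div_self (pow_ne_zero 2 ht0.ne')]
  have hcs' : (a / t) ^ 2 + (-b / t) ^ 2 = 1 := by rw [neg_div, neg_sq]; exact hcs
  have eW : t • ((a / t) • u + (b / t) • v) = a • u + b • v := by
    rw [smul_add, smul_smul, smul_smul, mul_div_cancel₀ _ ht0.ne', mul_div_cancel₀ _ ht0.ne']
  have eW' : t • ((a / t) • u + (-b / t) • v) = a • u + (-1 : ℝ) • (b • v) := by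
    rw [smul_add, smul_smul, smul_smul, smul_smul, mul_div_cancel₀ _ ht0.ne', mul_div_cancel₀ _ ht0.ne', neg_one_mul]
  have hLW := leakBound_smul β (hleak_rot _ _ hcs) t
  have hLW' := leakBound_smul β (hleak_rot _ _ hcs') t
  rw [eW] at hLW
  rw [eW'] at hLW'
  have key := ritz_sub_sq_le_unit β hU hV h1U h1V (leakBound_smul β hleak_u a) (leakBound_smul β hleak_v b) hLW hLW'
  have hrU : l2 u (transferApply β u) / l2 u u = l2 (a • u) (transferApply β (a • u)) := by
    rw [transferApply_smul, l2_smul_left, l2_smul_right'', div_eq_iff hnu.ne']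
    calc l2 u (transferApply β u) = (a ^ 2 * l2 u u) * l2 u (transferApply β u) := by rw [ha2, one_mul]
      _ = a * (a * l2 u (transferApply β u)) * l2 u u := by ring
  have hrV : l2 v (transferApply β v) / l2 v v = l2 (b • v) (transferApply β (b • v)) := by
    rw [transferApply_smul, l2_smul_left, l2_smul_right'', div_eq_iff hnv.ne']
    calc l2 v (transferApply β v) = (b ^ 2 * l2 v v) * l2 v (transferApply β v) := by rw [hb2, one_mul]
      _ = b * (b * l2 v (transferApply β v)) * l2 v v := by ring
  rw [hrU, hrV]
  exact key

end RitzAgreement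

/-! ## §4 ★★ The necessary condition of the registered leakage text across a degenerate level -/

/-- ★★ **RITZ-VALUE AGREEMENT across a degenerate level — a necessary condition of the registered leakage text `LeakageForL (TransplantBasisLR k)`**
(r8 `stub_liftLeakage`) with the SAME `C, lam0, L0(lam)`: for `β` in the femto window, raw vacuum `φ`, AL1 family `f` (`f_0 > 0`), admissible `R` and every
pair of excited indices `a ≠ b` with `physLevel (a+2) = physLevel (b+2)` whose dressed lifts `u_i = dressedLiftVec β φ (transplantObsL L λ R f i)` are non-null:
`(⟨u_a,K_βu_a⟩/‖u_a‖² − ⟨u_b,K_βu_b⟩/‖u_b‖²)² ≤ 32·C·(λ³/L²)·λ₀²`.  Proof: the basis rotated inside the level is admissible (`transplantBasisLR_levelRotation`)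
and its dressed lifts are the rotated dressed lifts, so (o4) holds for every rotation of the pair; then `ritz_sub_sq_le_of_rotationLeakage`.  Bites on the
`E⁺ ⊕ T₂⁺` quintet (from `k = 2`); physically met. [cite: Luscher1983, §2–§3] [cite: LuscherMunster1984, §4] [cite: Vanbaal2001, §4] [cite: LuscherWolff1990] -/
theorem leakageForL_transplantLR_levelRitzAgreement (k : ℕ) (hK : LeakageForL (TransplantBasisLR k)) :
    ∃ C lam0 : ℝ, 0 ≤ C ∧ 0 < lam0 ∧ ∀ lam : ℝ, 0 < lam → lam ≤ lam0 → ∃ L0 : ℕ,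
      ∀ (L : ℕ) [NeZero L], L0 ≤ L → ∀ β : ℝ, InFemtoWindow lam β L →
        ∀ φ : GaugeConfig 3 L SU2 → ℝ, IsRawVacuum β φ →
          ∀ (f : Fin (k + 1) → ZM → ℝ) (R : ℝ), IsEigenFamily k f → (∀ x, 0 < f 0 x) → 1 ≤ R →
            1 ≤ R ^ 4 * luscherLambda β L → R * luscherLambda β L ≤ 1 / 4 →
              ∀ a b : Fin k, a ≠ b → physLevel ((a : ℕ) + 2) = physLevel ((b : ℕ) + 2) →
                let ua := dressedLiftVec β φ (transplantObsL L (luscherLambda β L) R f a)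
                let ub := dressedLiftVec β φ (transplantObsL L (luscherLambda β L) R f b)
                0 < l2 ua ua → 0 < l2 ub ub →
                  (l2 ua (transferApply β ua) / l2 ua ua - l2 ub (transferApply β ub) / l2 ub ub) ^ 2 ≤
                    32 * C * (luscherLambda β L ^ 3 / (L : ℝ) ^ 2) * levelValue su2Rep L β 0 ^ 2 := by
  obtain ⟨C, lam0, hC, hlam0, hmain⟩ := hK
  refine ⟨C, lam0, hC, hlam0, fun lam hlam hle => ?_⟩
  obtain ⟨L0, hL⟩ := hmain lam hlam hle
  refine ⟨L0, fun L _ hL0 β hW φ hφ f R hf hpos hR1 hR4 hRΛ a b hab hdeg => ?_⟩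
  intro ua ub hna hnb
  have hgB : TransplantBasisLR k L (luscherLambda β L) (fun i => transplantObsL L (luscherLambda β L) R f i) :=
    ⟨f, R, hf, hpos, hR1, hR4, hRΛ, fun _ => rfl⟩
  set Ta := transplantObsL L (luscherLambda β L) R f a with hTa
  set Tb := transplantObsL L (luscherLambda β L) R f b with hTb
  have hTa_phys : IsPhys Ta := basisPhysL_transplantBasisLR k L _ _ hgB a
  have hTb_phys : IsPhys Tb := basisPhysL_transplantBasisLR k L _ _ hgB b
  have hua_phys : IsPhys ua := isPhys_dressedLiftVec β hφ.1 hTa_phys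
  have hub_phys : IsPhys ub := isPhys_dressedLiftVec β hφ.1 hTb_phys
  set E : ℝ := C * (luscherLambda β L ^ 3 / (L : ℝ) ^ 2) * levelValue su2Rep L β 0 ^ 2 with hE
  have hLC : LeakageClause k C β (dressedLiftFamily β φ (fun i => transplantObsL L (luscherLambda β L) R f i)) := hL L hL0 β hW φ hφ _ hgB
  have hleak_u : l2 (transferApply β ua) (transferApply β ua) * l2 ua ua - l2 ua (transferApply β ua) ^ 2 ≤ E * l2 ua ua ^ 2 := by
    have h := hLC a; rw [hE]; exact h
  have hleak_v : l2 (transferApply β ub) (transferApply β ub) * l2 ub ub - l2 ub (transferApply β ub) ^ 2 ≤ E * l2 ub ub ^ 2 := by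
    have h := hLC b; rw [hE]; exact h
  -- (o4) for every rotation of the pair inside the degenerate level
  have hleak_rot : ∀ c s : ℝ, c ^ 2 + s ^ 2 = 1 →
      l2 (transferApply β (c • ua + s • ub)) (transferApply β (c • ua + s • ub)) * l2 (c • ua + s • ub) (c • ua + s • ub) -
          l2 (c • ua + s • ub) (transferApply β (c • ua + s • ub)) ^ 2 ≤ E * l2 (c • ua + s • ub) (c • ua + s • ub) ^ 2 := by
    intro c s hcs
    obtain ⟨g', hga, hgb, hgj⟩ : ∃ g' : Fin k → (Cfg → ℝ),
        g' a = c • Ta + s • Tb ∧ g' b = (-s) • Ta + c • Tb ∧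
          ∀ i, i ≠ a → i ≠ b → g' i = transplantObsL L (luscherLambda β L) R f i :=
      ⟨fun i => if i = a then c • Ta + s • Tb else if i = b then (-s) • Ta + c • Tb else transplantObsL L (luscherLambda β L) R f i,
        by simp, by simp [hab.symm], fun i h1 h2 => by simp [h1, h2]⟩
    have hg'B : TransplantBasisLR k L (luscherLambda β L) g' :=
      transplantBasisLR_levelRotation hgB hab hdeg.symm hcs hga hgb hgj
    have hLC' : LeakageClause k C β (dressedLiftFamily β φ g') := hL L hL0 β hW φ hφ g' hg'B
    have e_a : dressedLiftFamily β φ g' a = c • ua + s • ub := by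
      show dressedLiftVec β φ (g' a) = _
      rw [hga, dressedLiftVec_add β hφ.1 (hTa_phys.smul c) (hTb_phys.smul s), dressedLiftVec_smul, dressedLiftVec_smul]
    have h := hLC' a
    rw [e_a] at h
    rw [hE]; exact h
  have hmain := ritz_sub_sq_le_of_rotationLeakage β hua_phys hub_phys hna hnb hleak_u hleak_v hleak_rot
  calc _ ≤ 32 * E := hmain
    _ = 32 * C * (luscherLambda β L ^ 3 / (L : ℝ) ^ 2) * levelValue su2Rep L β 0 ^ 2 := by rw [hE]; ring

/-- ★★ **The same necessary condition with non-nullity discharged** (by `o0_level_transplantLR`: every dressed lift of an r7/r8 basis is non-null once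
`lam ≤ 1/(2((3·physLevel(k+1)/2)⁴+1))`), at the price of a possibly smaller `lam0`. [cite: Luscher1983, §2–§3] [cite: Vanbaal2001, §4] [cite: LuscherWolff1990] -/
theorem leakageForL_transplantLR_levelRitzAgreement' (k : ℕ) (hK : LeakageForL (TransplantBasisLR k)) :
    ∃ C lam0 : ℝ, 0 ≤ C ∧ 0 < lam0 ∧ ∀ lam : ℝ, 0 < lam → lam ≤ lam0 → ∃ L0 : ℕ,
      ∀ (L : ℕ) [NeZero L], L0 ≤ L → ∀ β : ℝ, InFemtoWindow lam β L →
        ∀ φ : GaugeConfig 3 L SU2 → ℝ, IsRawVacuum β φ →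
          ∀ (f : Fin (k + 1) → ZM → ℝ) (R : ℝ), IsEigenFamily k f → (∀ x, 0 < f 0 x) → 1 ≤ R →
            1 ≤ R ^ 4 * luscherLambda β L → R * luscherLambda β L ≤ 1 / 4 →
              ∀ a b : Fin k, a ≠ b → physLevel ((a : ℕ) + 2) = physLevel ((b : ℕ) + 2) →
                let ua := dressedLiftVec β φ (transplantObsL L (luscherLambda β L) R f a)
                let ub := dressedLiftVec β φ (transplantObsL L (luscherLambda β L) R f b)
                (l2 ua (transferApply β ua) / l2 ua ua - l2 ub (transferApply β ub) / l2 ub ub) ^ 2 ≤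
                  32 * C * (luscherLambda β L ^ 3 / (L : ℝ) ^ 2) * levelValue su2Rep L β 0 ^ 2 := by
  obtain ⟨C, lam0, hC, hlam0, hmain⟩ := leakageForL_transplantLR_levelRitzAgreement k hK
  obtain ⟨lam1, hlam1, h0⟩ := o0_level_transplantLR k
  refine ⟨C, min lam0 lam1, hC, lt_min hlam0 hlam1, fun lam hlam hle => ?_⟩
  obtain ⟨L0, hL⟩ := hmain lam hlam (hle.trans (min_le_left _ _))
  refine ⟨L0, fun L _ hL0 β hW φ hφ f R hf hpos hR1 hR4 hRΛ a b hab hdeg => ?_⟩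
  intro ua ub
  have hgB : TransplantBasisLR k L (luscherLambda β L) (fun i => transplantObsL L (luscherLambda β L) R f i) :=
    ⟨f, R, hf, hpos, hR1, hR4, hRΛ, fun _ => rfl⟩
  have ho0 := h0 lam hlam (hle.trans (min_le_right _ _)) L β hW φ hφ _ hgB
  exact hL L hL0 β hW φ hφ f R hf hpos hR1 hR4 hRΛ a b hab hdeg (ho0 a) (ho0 b)

/-! ## §5 Sharpness of the order: the singleton leakage clause of an equal mixture of two orthonormal exact eigenvectors -/

/-- **The equal mixture passes (o4) iff the splitting is at most `2√C·λ^{3/2}λ₀/L`**: for orthonormal physical exact eigenvectors `K_βψ_i = κ_iψ_i`,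
`LeakageClause 1 C β (fun _ => ψ₁ + ψ₂) ↔ (κ₁ − κ₂)² ≤ 4·C(λ³/L²)λ₀²` — so §4's necessary condition has the sharp ORDER (constant `32` vs `4`). [cite: LuscherWolff1990] -/
theorem leakageClause_mixture_iff {L : ℕ} [NeZero L] (β C : ℝ) {ψ₁ ψ₂ : GaugeConfig 3 L SU2 → ℝ} {κ₁ κ₂ : ℝ} (h₁ : IsPhys ψ₁) (h₂ : IsPhys ψ₂)
    (he₁ : transferApply β ψ₁ = κ₁ • ψ₁) (he₂ : transferApply β ψ₂ = κ₂ • ψ₂)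
    (hn₁ : l2 ψ₁ ψ₁ = 1) (hn₂ : l2 ψ₂ ψ₂ = 1) (h₁₂ : l2 ψ₁ ψ₂ = 0) :
    LeakageClause 1 C β (fun _ => ψ₁ + ψ₂) ↔
      (κ₁ - κ₂) ^ 2 ≤ 4 * (C * (luscherLambda β L ^ 3 / (L : ℝ) ^ 2) * levelValue su2Rep L β 0 ^ 2) := by
  constructor
  · intro h
    have h0 := h 0
    dsimp only at h0
    rw [leakage_defect_of_mixture β h₁ h₂ he₁ he₂ hn₁ hn₂ h₁₂, l2_mixture_self h₁ h₂ hn₁ hn₂ h₁₂] at h0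
    linarith
  · intro h i
    dsimp only
    rw [leakage_defect_of_mixture β h₁ h₂ he₁ he₂ hn₁ hn₂ h₁₂, l2_mixture_self h₁ h₂ hn₁ hn₂ h₁₂]
    linarith

end Summit.QuantumFields.YangMills.Theorems.FemtoTransferGap.PolyakovLift.Negative

end
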